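import Summits.BirchSwinnertonDyer.Rank1Residual.X10.JetchevTamagawaRecords
import Literature.NumberTheory.EllipticCurves.Rank1Residual.Predicates
import HarnessLib

/-!
# Leaf `CornerF ∧ p ramified in K` (K12r = O11): the CERTIFICATE-RECORD SCHEMA — one computable record
# per census cell `(isogeny class, p)` with an in-kernel recheck (cell `bsd-print-cfram`, D-0131 (2)
# PRINT tier, typer seat `ty3`; LADDER-BSD §1b row K7r = scoreboard row B13)

HONEST FRAMING (cell `bsd-print-cfram`, run/shared/lean/pub/bsd-print-cfram/, verbatim in every file
of the cell): PARTITION currency only — the leaf counts when its class theorem is in the kernel BY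
NAME, flag-free; Literature named facts are statement-only with cite tags, never sorried theorems;
every imported theorem carries its printed hypotheses verbatim; numbers, not adjectives. THIS FILE IS
DATA INFRASTRUCTURE: computable records and a decidable recheck. Nothing about any elliptic curve is
asserted, no named fact is introduced, nothing is booked, no mark moves (K12r stays OPEN: rung leaves
`Summit.BirchSwinnertonDyer.WAllCornerFRamifiedAtThree` / `…FiveLe`, `X12.CMRamifiedSeven`).

## The leaf and its census cells

The leaf is `CornerF W p ∧ CMRamified W p` (`Partition/CornersCM.lean`, `Rank1Residual/Predicates.lean`):
`W/ℚ` globally minimal with CM, `ord_{s=1} L(E,s) = 1`, `p` odd with `p ∣ d_K` — hence `p = 3 ∧ K =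
ℚ(√−3)` (`j ∈ {0, 54000, −12288000}`), or `p = |d_K| ∈ {7, 11, 19, 43, 67, 163}`; `p` is then a bad,
additive, potentially supersingular prime with `E[p]` reducible (`X12/CMRamifiedAdditive.lean`,
`X12/CMRamifiedReducible.lean`, `X12/RamifiedLocalTypes.lean`). Census cells of record (unit =
(Cremona isogeny class, `p`); scoreboard `pub/pub-bsdres/PARTITION-SCOREBOARD.md` row B13; RESIDUAL-MAP.md
§F addendum 8 / §I O11): at `p ≥ 5`, **65** pairs with `N < 5·10⁵` (`(d_K, p)`: `(−7,7)` 26 ·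
`(−11,11)` 18 · `(−19,19)` 12 · `(−43,43)` 5 · `(−67,67)` 3 · `(−163,163)` 1; all Kodaira `III` on
curve 1; **36** of them residue cells of record R196.10), among them the five curves of the class 𝒞₇
(`X12/CMSevenAwayFromSeven.lean`: `5929e, 25921a, 219961e, 247009h, 305809c`); at `p = 3`, **98**
classes with `N < 2·10⁴` (of 919 below `5·10⁵`; curve 1 has `j = 0` in all 98), plus the two
beyond-window EXCESS-2 classes `309123c/d` (`#Ш_an = 9`), the only K12r@3 residue cells of record.
On every one of the 65 + 98 window cells `#Ш_an = 1`, so Miller's `BSD(E,p)` there reads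
`Ш(E/ℚ)[p] = 0` (given `rank = r_an = 1` and `#Ш < ∞`, Gross–Zagier–Kolyvagin).

## What a record holds (`CMRamifiedRow`) and what the kernel rechecks (`CMRamifiedRow.consistent`)

Per cell: the Cremona label of curve 1 (the `Γ₀(N)`-optimal curve; Cremona `opt_man` code and Manin
constant are fields), its minimal a-invariants, `N` with its prime factorisation, `j`, `d_K`, `p`,
`ord_p N`, `ord_p Δ_min`, the Kodaira symbol (PARI code: `1 = I₀, 2 = II, 3 = III, 4 = IV, 4+ν = Iν,
−1 = I₀*, −2 = II*, −3 = III*, −4 = IV*, −4−ν = Iν*`) and `c_p` at `p`; the UNTWIST — for `p ≥ 5` the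
Gross curve `A` of conductor `d_K²` (Cremona `49a1 / 121b1 / 361a1 / 1849a1 / 4489a1 / 26569a1`) and
the square-free `D` with `E ≅ A^{(D)}`, for `p = 3` the sixth-power-free `k` with `E ≅ (y² = x³ + k)`
— with the scaling `u = u₁/u₂` making the `c₄/c₆` identities exact; the rank data (`r = 1` of
Cremona's table, root number and analytic rank of ENGINE P, a Mordell–Weil generator modulo torsion
in weighted integral coordinates `(X/d², Y/d³)` with its saturation index); the BSD data
(`#E(ℚ)_tors`, the per-prime Tamagawa numbers, `#Ш_an` rounded, each with its engine count, and
their `ord_p`); the isogeny class (per member: a-invariants, `j`, `#tors`, `∏c_ℓ`, `#Ш_an`,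
`ord_p Δ_min`); two bookkeeping bits (residue cell of record R196.10; membership in 𝒞₇) and the
engine provenance string.
ENGINES: T = Cremona's `ecdata` (`allbsd`, `allgens`, `opt_man`; Cremona 1997 / 2006), P = PARI/GP
(`ellglobalred`, `elllocalred`, `elltors`, `ellrootno`, `ellanalyticrank`, `ellsaturation`,
`ellheight`, `ellbsd`; kit jobs named in each display file). "Two engines" for `#tors`, `∏c_ℓ`,
`#Ш_an` (T's column vs P's recomputation `L'(E,1)/(ellbsd·R)`, agreement to `10⁻²⁵`), for the rank
(T: Cremona's rank column; P: `ellanalyticrank = [1, L'(E,1)]`, root number `−1`) and for the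
generator (T: `allgens`; P: on the curve, `ellsaturation` index `1`); the per-prime `c_ℓ` and the
Kodaira symbols are P's, their product certified against T's `∏c_ℓ`.
`consistent` RECHECKS by `decide`, on the recorded integers only, in eight named blocks: `shapeOK`
(five a-invariants, trial-division factorisation of `N`, optimality code `≥ 1`, Manin constant `1`),
`cmOK` (`c₄³ = j·Δ` with `j` one of the thirteen, `d_K = cmFieldDiscrOfJInt j` — the `ℤ`-mirror of
the tree's `cmFieldDiscrOfJ`, bridge lemma `cmFieldDiscrOfJ_intCast` —, `p ∣ d_K`, and the slice
`p = 3 ∨ 5 ≤ p = |d_K|`), `localOK` (`p² ∣ N` with the recorded exponent, `ord_p Δ_min` recomputed;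
at `p ≥ 5`: `ord_p Δ_min = 3`, Kodaira code `3 = III`, `c_p = 2`), `twistOK` (`c₄(E)·u₁⁴ =
D²·c₄(A)·u₂⁴`, `c₆(E)·u₁⁶ = D³·c₆(A)·u₂⁶` with `A` CM in the same field and `D` square-free, `p ∤ D`
at `p ≥ 5`; resp. `c₄(E) = 0`, `c₆(E)·u₁⁶ = −864·k·u₂⁶`, `k` sixth-power-free), `rankOK` (rank `1`,
root number `−1`, two engines; the generator ON THE CURVE exactly, saturation index `1`), `bsdOK`
(Tamagawa primes = primes of `N`, product = the recorded `∏c_ℓ`, `c_p` = the entry at `p`; `ord_p`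
of `#tors`, `∏c_ℓ`, `#Ш_an` as recorded; engine counts `≥ 2`), `classOK` (curve 1 is the record's
curve; every member CM in the same field and, at `p ≥ 5`, of type `III`/`III*`: `ord_p Δ ∈ {3, 9}`),
and the 𝒞₇ bit equals the recomputed `cSevenBit` (`d_K = −7`, `2 ∤ N`, `a₂` odd, every `q ∣ N`,
`q ≠ 7`, split in `ℚ(√−7)` by Euler's criterion). NOT rechecked (engines' work): conductor = `N`,
minimality, `r_an = 1`, saturation, `#Ш_an`.

## How the provers' discharges consume it

A by-name closure of the leaf (`PrintCfram` route) that keeps per-pair hypotheses — `shaAn W = q`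
with `ord_p q = 0`, `p ∤ #E(ℚ)_tors·∏c_ℓ`, a generator / its `p`-divisibility level, the untwist
`W ≅ A^{(D)}` or `W ≅ E_k`, the Kodaira type at `p` — reads them off the row of the cell; the display
files `X12/CMRamifiedRecordsFiveLe{A,B,C}.lean` (the 65, one theorem per prime, 𝒞₇ apart) and
`X12/CMRamifiedRecordsThree{A,B,C,D}.lean` (the 98 + 2) state `rows.all consistent = true` (by `decide`),
and the cell referee samples rows against an independent engine. Helpers are REUSED from `Theorems/Rank1ResidualX10bHeegnerIndexRecords.lean`
(`vp`, `bInv`, `discr`, `c4`, `factorsOK`, `cmJs`, `weierstrassEvalZ`) and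
`X10/JetchevTamagawaRecords.lean` (`c6`, `isNonzeroSquareMod`, `tamAt`); nothing re-declared.

References: LADDER-BSD.md §1b (K7r / B13); PARTITION-SCOREBOARD.md row B13; RESIDUAL-MAP.md §F add. 8,
§I O11; `b2b-bsdres-x1b/gen23/e2/O10-O11-SUBPARTITION.tsv` (07dee74c40ebb361); Cremona, *Algorithms for
Modular Elliptic Curves* (1997) Table 1 and `ecdata` [Cremona1997]; Silverman *ATAEC* IV.9.4 Table 4.1
(Kodaira `III`: `ord Δ = 3`, `c = 2`), App. A §3 [SilvermanATAEC1994]; Gross, LNM 776 §§22–24 (`A(p)`);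
Miller 2011 Def. 1.1 [Miller2011LMS].
-/

set_option autoImplicit false

namespace Summit.BirchSwinnertonDyer.Rank1Residual.X12.CMRamifiedRecords

open Summit.BirchSwinnertonDyer.BirchSwinnertonDyer.Rank1Residual.HeegnerIndexRecords
open Summit.BirchSwinnertonDyer.Rank1Residual.X10.JetchevTamagawaRecords (c6 isNonzeroSquareMod tamAt)

/-! ### §1 Helpers (computable; integer arithmetic only) -/

/-- The `ℤ`-mirror of the tree's `Rank1Residual.cmFieldDiscrOfJ` (fundamental discriminant `d_K` of
the CM field read off a rational CM `j`-invariant; junk `0` otherwise), so that `decide` can evaluate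
it; agreement on integer casts is `cmFieldDiscrOfJ_intCast`. [cite: SilvermanATAEC1994, App. A §3 (table of CM j-invariants)] -/
def cmFieldDiscrOfJInt (j : ℤ) : ℤ :=
  if j = 0 ∨ j = 54000 ∨ j = -12288000 then -3
  else if j = 1728 ∨ j = 287496 then -4
  else if j = -3375 ∨ j = 16581375 then -7
  else if j = 8000 then -8
  else if j = -32768 then -11
  else if j = -884736 then -19
  else if j = -884736000 then -43
  else if j = -147197952000 then -67
  else if j = -262537412640768000 then -163
  else 0

/-- **Bridge to the tree predicate vocabulary**: on an integer `j` the tree's `cmFieldDiscrOfJ`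
(`Rank1Residual/Predicates.lean`, over `ℚ`) is `cmFieldDiscrOfJInt j`. So for a curve `W` with
`W.j = (r.j : ℚ)` the record's `dK` field (checked `= cmFieldDiscrOfJInt r.j`) IS `cmFieldDiscrOfJ W.j`,
and `CMRamified W p` (`(p : ℤ) ∣ cmFieldDiscrOfJ W.j`) is the record's clause `p ∣ dK`. [folklore] -/
theorem cmFieldDiscrOfJ_intCast (j : ℤ) :
    Literature.NumberTheory.EllipticCurves.Rank1Residual.cmFieldDiscrOfJ ((j : ℤ) : ℚ) =
      cmFieldDiscrOfJInt j := by
  unfold Literature.NumberTheory.EllipticCurves.Rank1Residual.cmFieldDiscrOfJ cmFieldDiscrOfJInt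
  norm_cast

/-- CM test on five a-invariants with a recorded `j`: `j` is one of the thirteen rational CM
invariants, `Δ ≠ 0`, and `c₄³ = j·Δ` (i.e. `j(E) = c₄³/Δ = j`). [folklore] -/
def isCMWithJ (a : List ℤ) (j : ℤ) : Bool :=
  (cmJs.any fun j' => j' == j) && (discr a != 0) && (c4 a ^ 3 == j * discr a)

/-- `q` splits in the imaginary quadratic field of discriminant `dK`: `dK ≡ 1 (mod 8)` at `q = 2`,
`dK` a non-zero square mod `q` (Euler's criterion) at odd `q` — the Boolean shadow of the tree's
`CMSplit`. [folklore] -/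
def splitIn (dK : ℤ) (q : ℕ) : Bool :=
  if q = 2 then dK % 8 == 1 else isNonzeroSquareMod dK q

/-- `a₂ = 2 + 1 − #E(𝔽₂)` by counting the affine points of the reduction mod `2` (meaningful when `2 ∤ N`). [folklore] -/
def aTwo (a : List ℤ) : ℤ :=
  match a with
  | [a1, a2, a3, a4, a6] =>
      let onCurve : ℕ → ℕ → Bool := fun x y =>
        (((y : ℤ) * (y : ℤ) + a1 * (x : ℤ) * (y : ℤ) + a3 * (y : ℤ) -
          ((x : ℤ) ^ 3 + a2 * (x : ℤ) ^ 2 + a4 * (x : ℤ) + a6)) % 2) == 0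
      let pts := ((List.range 2).flatMap fun x => (List.range 2).filter fun y => onCurve x y).length
      3 - (1 + (pts : ℤ))
  | _ => 0

/-- `n ≠ 0` is square-free, checked on a recorded prime factorisation `fs` of `|n|` (all exponents `1`;
`|n| = 1` has the empty factorisation). [folklore] -/
def squarefreeByFactors (n : ℤ) (fs : List (ℕ × ℕ)) : Bool :=
  (n != 0) && factorsOK n.natAbs fs && fs.all (fun qe => qe.2 == 1)

/-- `k ≠ 0` is sixth-power-free, checked on a recorded prime factorisation `fs` of `|k|`. [folklore] -/
def sixthPowerFreeByFactors (k : ℤ) (fs : List (ℕ × ℕ)) : Bool :=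
  (k != 0) && factorsOK k.natAbs fs && fs.all (fun qe => decide (qe.2 ≤ 5))

/-! ### §2 The record types -/

/-- One member of the isogeny class (Cremona numbering): minimal a-invariants, `j`, `#E(ℚ)_tors`,
`∏c_ℓ`, `#Ш_an` (rounded; ENGINE T only for members other than curve 1) and `ord_p Δ_min`. [folklore] -/
structure MemberRow where
  num : ℕ
  ainvs : List ℤ
  j : ℤ
  tors : ℕ
  tam : ℕ
  shaAn : ℕ
  ordpDisc : ℕ

/-- **One certificate record of the leaf `CornerF ∧ CMRamified`** — a census cell `(class, p)`; the
field dictionary is the module docstring. Untwist fields: `twistKind = 2` (quadratic twist of the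
Gross curve `baseAinvs` by the square-free `twistD`, factorisation `twistDfactors` of `|twistD|`) or
`twistKind = 6` (`j = 0`: `E ≅ y² = x³ + twistD`, `twistD` sixth-power-free), scaling `u = u1/u2`.
Generator `(gX/gd², gY/gd³)`. `kodCode` is PARI's Kodaira code at `p`. Strings are display-only
(labels, decimal expansions, job ids). [folklore] -/
structure CMRamifiedRow where
  label : String
  cls : String
  ainvs : List ℤ
  N : ℕ
  Nfactors : List (ℕ × ℕ)
  optcode : ℕ
  manin : ℕ
  j : ℤ
  dK : ℤ
  p : ℕ
  ordpN : ℕ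
  ordpDisc : ℕ
  kodP : String
  kodCode : ℤ
  cP : ℕ
  twistKind : ℕ
  baseLabel : String
  baseAinvs : List ℤ
  twistD : ℤ
  twistDfactors : List (ℕ × ℕ)
  u1 : ℕ
  u2 : ℕ
  rank : ℕ
  rootno : ℤ
  rankEngines : ℕ
  lDeriv : String
  gX : ℤ
  gY : ℤ
  gd : ℕ
  satIndex : ℕ
  reg : String
  omega : String
  tors : ℕ
  torsEngines : ℕ
  tam : ℕ
  tamPrimes : List (ℕ × ℕ)
  tamEngines : ℕ
  shaAn : ℕ
  shaAnEngines : ℕ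
  ordpTors : ℕ
  ordpTam : ℕ
  ordpShaAn : ℕ
  members : List MemberRow
  residueOfRecord : Bool
  classCSeven : Bool
  engines : String

namespace CMRamifiedRow

/-- Block 1: five a-invariants, `N` = ∏ of its recorded prime-power factorisation (bases prime by trial
division), Cremona optimality code `≥ 1`, Manin constant `1`. [folklore] -/
def shapeOK (r : CMRamifiedRow) : Bool :=
  (r.ainvs.length == 5) && factorsOK r.N r.Nfactors && decide (1 ≤ r.optcode) && (r.manin == 1)

/-- Block 2: CM with the recorded `j`, `d_K = cmFieldDiscrOfJInt j`, `p ∣ d_K` (ramified), and the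
slice `p = 3 ∨ (5 ≤ p ∧ d_K = −p)`. [folklore] -/
def cmOK (r : CMRamifiedRow) : Bool :=
  isCMWithJ r.ainvs r.j && (cmFieldDiscrOfJInt r.j == r.dK) && (r.dK % (r.p : ℤ) == 0) &&
    (r.p == 3 || (decide (5 ≤ r.p) && (r.dK == -(r.p : ℤ))))

/-- Block 3: additive at `p` — `p^{ordpN} ∥ N` with `ordpN ≥ 2`; `ord_p Δ_min` recomputed; at
`p ≥ 5`: `ord_p Δ_min = 3`, Kodaira code `3` (`III`), `c_p = 2` (Tate's algorithm, *ATAEC* IV.9.4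
Table 4.1). [folklore] -/
def localOK (r : CMRamifiedRow) : Bool :=
  decide (2 ≤ r.ordpN) && (r.Nfactors.any fun qe => qe.1 == r.p && qe.2 == r.ordpN) &&
    (vp r.p (discr r.ainvs) == r.ordpDisc) &&
    (r.p == 3 || (r.ordpDisc == 3 && r.kodCode == 3 && r.cP == 2))

/-- Block 4: the untwist identities (module docstring): quadratic (`twistKind = 2`) —
`c₄(E)u₁⁴ = D²c₄(A)u₂⁴`, `c₆(E)u₁⁶ = D³c₆(A)u₂⁶`, `A` CM in the same field, `D` square-free and prime
to `p`; sextic (`twistKind = 6`) — `c₄(E) = 0`, `c₆(E)u₁⁶ = −864·k·u₂⁶`, `k` sixth-power-free. [folklore] -/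
def twistOK (r : CMRamifiedRow) : Bool :=
  decide (1 ≤ r.u1) && decide (1 ≤ r.u2) &&
  ((r.twistKind == 2 && (r.baseAinvs.length == 5) &&
      (cmJs.any fun j' => (discr r.baseAinvs != 0) && (c4 r.baseAinvs ^ 3 == j' * discr r.baseAinvs) &&
        (cmFieldDiscrOfJInt j' == r.dK)) &&
      squarefreeByFactors r.twistD r.twistDfactors && (r.twistD % (r.p : ℤ) != 0) &&
      (c4 r.ainvs * (r.u1 : ℤ) ^ 4 == r.twistD ^ 2 * c4 r.baseAinvs * (r.u2 : ℤ) ^ 4) &&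
      (c6 r.ainvs * (r.u1 : ℤ) ^ 6 == r.twistD ^ 3 * c6 r.baseAinvs * (r.u2 : ℤ) ^ 6)) ||
   (r.twistKind == 6 && (c4 r.ainvs == 0) && sixthPowerFreeByFactors r.twistD r.twistDfactors &&
      (c6 r.ainvs * (r.u1 : ℤ) ^ 6 == -864 * r.twistD * (r.u2 : ℤ) ^ 6)))

/-- Block 5: rank data — Cremona rank `1`, ENGINE P root number `−1`, two rank engines; the recorded
generator lies ON THE CURVE (weighted integral Weierstrass equation, exact) and is saturated
(index `1`). [folklore] -/
def rankOK (r : CMRamifiedRow) : Bool :=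
  (r.rank == 1) && (r.rootno == -1) && decide (2 ≤ r.rankEngines) &&
    decide (1 ≤ r.gd) && (weierstrassEvalZ r.ainvs r.gX r.gY r.gd == 0) && (r.satIndex == 1)

/-- Block 6: BSD data — `#tors ≥ 1`; the per-prime Tamagawa list has the primes of `N`, product the
recorded `∏c_ℓ`, entry `c_p` at `p`; `#Ш_an ≥ 1`; the recorded `ord_p` of `#tors`, `∏c_ℓ`, `#Ш_an`
are the computed ones; engine counts `≥ 2`. [folklore] -/
def bsdOK (r : CMRamifiedRow) : Bool :=
  decide (1 ≤ r.tors) && decide (2 ≤ r.torsEngines) &&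
  (r.tamPrimes.map Prod.fst == r.Nfactors.map Prod.fst) &&
  (r.tamPrimes.foldl (fun acc qc => acc * qc.2) 1 == r.tam) && decide (2 ≤ r.tamEngines) &&
  (tamAt r.tamPrimes r.p == r.cP) &&
  decide (1 ≤ r.shaAn) && decide (2 ≤ r.shaAnEngines) &&
  (vp r.p r.tors == r.ordpTors) && (vp r.p r.tam == r.ordpTam) && (vp r.p r.shaAn == r.ordpShaAn)

/-- One class member is consistent with a record of field `dK` at `p`: five a-invariants, CM with its
recorded `j` in the SAME CM field, `ord_p Δ_min` as recorded and, at `p ≥ 5`, Kodaira type `III` or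
`III*` (`ord_p Δ_min ∈ {3, 9}`); positive `#tors`, `∏c_ℓ`, `#Ш_an`. [folklore] -/
def _root_.Summit.BirchSwinnertonDyer.Rank1Residual.X12.CMRamifiedRecords.MemberRow.okFor
    (m : MemberRow) (dK : ℤ) (p : ℕ) : Bool :=
  (m.ainvs.length == 5) && isCMWithJ m.ainvs m.j && (cmFieldDiscrOfJInt m.j == dK) &&
  (vp p (discr m.ainvs) == m.ordpDisc) && (p == 3 || m.ordpDisc == 3 || m.ordpDisc == 9) &&
  decide (1 ≤ m.tors) && decide (1 ≤ m.tam) && decide (1 ≤ m.shaAn)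

/-- Block 7: the isogeny class — curve `1` is the record's curve (same a-invariants, `#tors`, `∏c_ℓ`,
`#Ш_an`) and every member passes `MemberRow.okFor`. [folklore] -/
def classOK (r : CMRamifiedRow) : Bool :=
  decide (1 ≤ r.members.length) &&
  (r.members.any fun m => m.num == 1 && m.ainvs == r.ainvs && m.tors == r.tors && m.tam == r.tam &&
    m.shaAn == r.shaAn) &&
  r.members.all (fun m => m.okFor r.dK r.p)

/-- The 𝒞₇ bit RECOMPUTED from the record (`X12.ClassCSeven`: CM by `ℚ(√−7)`, `r = 1`, good ordinary
at `2`, every bad `q ≠ 7` split in `K`): `d_K = −7`, `2 ∤ N`, `a₂` odd, and `(−7/q) = 1` for every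
prime `q ∣ N` other than `7`. [folklore] -/
def cSevenBit (r : CMRamifiedRow) : Bool :=
  (r.dK == -7) && (r.N % 2 == 1) && (aTwo r.ainvs % 2 != 0) &&
    r.Nfactors.all (fun qe => qe.1 == 7 || splitIn (-7) qe.1)

/-- **The in-kernel recheck of a record**: the seven blocks and the 𝒞₇ bit. [folklore] -/
def consistent (r : CMRamifiedRow) : Bool :=
  r.shapeOK && r.cmOK && r.localOK && r.twistOK && r.rankOK && r.bsdOK && r.classOK &&
    (r.classCSeven == r.cSevenBit)

/-- `consistent` unpacked into its eight blocks. [folklore] -/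
theorem consistent_iff (r : CMRamifiedRow) :
    r.consistent = true ↔
      r.shapeOK = true ∧ r.cmOK = true ∧ r.localOK = true ∧ r.twistOK = true ∧ r.rankOK = true ∧
        r.bsdOK = true ∧ r.classOK = true ∧ r.classCSeven = r.cSevenBit := by
  simp only [consistent, Bool.and_eq_true, beq_iff_eq]
  tauto

/-- A consistent record has `p ∣ d_K` with `d_K = cmFieldDiscrOfJInt j` — the record-level form of
`CMRamified` (see `cmFieldDiscrOfJ_intCast`) — and lies in the slice `p = 3 ∨ (5 ≤ p ∧ d_K = −p)`. [folklore] -/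
theorem dvd_dK_of_consistent {r : CMRamifiedRow} (h : r.consistent = true) :
    (r.p : ℤ) ∣ r.dK ∧ cmFieldDiscrOfJInt r.j = r.dK ∧ (r.p = 3 ∨ (5 ≤ r.p ∧ r.dK = -(r.p : ℤ))) := by
  obtain ⟨-, hcm, -⟩ := (consistent_iff r).1 h
  simp only [cmOK, Bool.and_eq_true, beq_iff_eq, Bool.or_eq_true, decide_eq_true_eq] at hcm
  obtain ⟨⟨⟨-, hdK⟩, hmod⟩, hs⟩ := hcm
  exact ⟨Int.dvd_of_emod_eq_zero hmod, hdK, hs⟩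

/-- A consistent record reads `ord_p #Ш_an`, `ord_p #E(ℚ)_tors`, `ord_p ∏c_ℓ` off its fields
(`vp` = the `p`-adic valuation helper of the X10b records). [folklore] -/
theorem vp_eq_of_consistent {r : CMRamifiedRow} (h : r.consistent = true) :
    vp r.p r.shaAn = r.ordpShaAn ∧ vp r.p r.tors = r.ordpTors ∧ vp r.p r.tam = r.ordpTam := by
  obtain ⟨-, -, -, -, -, hb, -⟩ := (consistent_iff r).1 h
  simp only [bsdOK, Bool.and_eq_true, beq_iff_eq, decide_eq_true_eq] at hb
  obtain ⟨⟨⟨-, ht⟩, hc⟩, hs⟩ := hb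
  exact ⟨hs, ht, hc⟩

/-- A consistent record's generator lies on the curve: the weighted integral Weierstrass equation
vanishes at `(gX, gY, gd)`. [folklore] -/
theorem weierstrassEvalZ_eq_zero_of_consistent {r : CMRamifiedRow} (h : r.consistent = true) :
    weierstrassEvalZ r.ainvs r.gX r.gY r.gd = 0 ∧ 1 ≤ r.gd := by
  obtain ⟨-, -, -, -, hr, -⟩ := (consistent_iff r).1 h
  simp only [rankOK, Bool.and_eq_true, beq_iff_eq, decide_eq_true_eq] at hr
  obtain ⟨⟨⟨-, hd⟩, hW⟩, -⟩ := hr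
  exact ⟨hW, hd⟩

end CMRamifiedRow

/-- A display file states `rs.all CMRamifiedRow.consistent = true` (a Boolean equation `decide`
evaluates; no `Prop`-valued definition is introduced); this unpacks it per member. [folklore] -/
theorem consistent_of_all {rs : List CMRamifiedRow} (h : rs.all CMRamifiedRow.consistent = true)
    {r : CMRamifiedRow} (hr : r ∈ rs) : r.consistent = true :=
  List.all_eq_true.1 h r hr

end Summit.BirchSwinnertonDyer.Rank1Residual.X12.CMRamifiedRecords
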